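import Literature.AlgebraicTopology.SingularHomology.ChainSubcomplex
import Literature.AlgebraicTopology.SingularHomology.Subdivision
import Literature.AlgebraicTopology.SingularHomology.PuncturedEuclidean
import HarnessLib

/-!
# Small chains, excision, Mayer–Vietoris, `H(ℝⁿ ∖ 0)`, spheres, and local homology `H(X | A)`

A. Hatcher, *Algebraic Topology*, CUP 2002, §2.1, Prop. 2.21 (p. 119) and Thm. 2.20 (excision,
p. 119, proof p. 124), §2.2 (Mayer–Vietoris sequences, pp. 149–150), Cor. 2.14 (p. 114:
`H̃ₙ(Sⁿ) ≅ ℤ` and `H̃ᵢ(Sⁿ) = 0` for `i ≠ n`, reduced homology) and §3.3 p. 231 (local homology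
`Hᵢ(X | A) := Hᵢ(X, X ∖ A)`), carried out in the concrete model `Literature.csingularChainComplex R M X`
of `Literature.AlgebraicTopology.SingularHomology.SingularChainsConcrete`, using the subdivision
operators of `…Subdivision`, the subcomplex/quotient algebra of `…ChainSubcomplex` and, for the
computations of Part II, the slit decomposition of `ℝⁿ ∖ {0}` of `…PuncturedEuclidean`. This is
the tool kit on which `…NoncompactManifoldProofs` proves Hatcher's Lemma 3.27 and Prop. 3.29.

**Part I — small chains and excision (§2.1).**

* `Literature.chainsInSub R M X A : Subcomplex (csingularChainComplex R M X)` — the subcomplex `C(A)` of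
  chains with image in `A` (`chainsInSub_inter`, `chainsInSub_univ`, `chainsInSub_sup_le`);
  `Literature.AlgebraicTopology.SingularHomology.smallChains`/`Literature.smallSub R M X U` — the subcomplex `C^𝒰 = ∑ᵢ C(Uᵢ)` of `𝒰`-small chains.
* `Literature.AlgebraicTopology.SingularHomology.exists_sdX_pow_mem_smallChains`: every chain with image in `⋃ Uᵢ` (`Uᵢ` open) becomes
  `𝒰`-small after iterated subdivision.
* **Prop. 2.21** `Literature.AlgebraicTopology.SingularHomology.isIso_homologyMap_incl_smallSub`: for `U` open with `Uᵢ ⊆ Y ⊆ ⋃ Uᵢ`, the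
  inclusion `C^𝒰 ↪ C(Y)` induces isomorphisms on all homology groups (proved: `Sʲ`, `Dⱼ` and
  `∂Dⱼ + Dⱼ∂ = 𝟙 - Sʲ` at the level of cycles and boundaries); corollaries
  `isIso_homologyMap_ι_smallSub` (`⋃ Uᵢ = X`), `isIso_homologyMap_incl_sup` and
  `isIso_homologyMap_ι_sup` (two open sets: `C(A) + C(B) ↪ C(A ∪ B)`), the input of Mayer–Vietoris.
* **Excision** `Literature.AlgebraicTopology.SingularHomology.isIso_homologyMap_quotMap_excision`: for open `Ω`, `C` covering `X`,
  `C(Ω)/C(Ω ∩ C) ⟶ C(X)/C(C)` induces isomorphisms on homology (Thm. 2.20 in the form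
  `H(B, A ∩ B) ≅ H(X, A)`; with `C = X ∖ A`: `H(Ω, Ω ∖ A) ≅ H(X, X ∖ A)`).
* `Literature.subspaceIso R M X A : csingularChainComplex R M ↥A ≅ (chainsInSub R M X A).toComplex` and the
  compatibility `chainsInSub_preimage_val` of "chains in `B`" under it.

**Part II — Mayer–Vietoris (concrete form) and the homology of the punctured spaces `ℝⁿ ∖ {0}`
(§2.2, Cor. 2.14)**, for `Literature.punctured n ⊆ (Fin n → ℝ)` (homotopy equivalent to `Sⁿ⁻¹`), which
is the form needed for local homology `H(ℝⁿ | x)` in Part III and `…NoncompactManifoldProofs`: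

* generalities: `isZero_csingularHomology_of_isEmpty`, `homologySubIso : H(C(A)) ≅ H(↥A)`;
* the Mayer–Vietoris short exact sequence `Literature.mvSES R M X A B` (`= Subcomplex.mvSub C(A) C(B)`,
  `mvSES_shortExact`) with its outer terms identified, `mvInterHomologyIso` (`H(X₁) ≅ H(A ∩ B)`) and
  `mvUnionHomologyIso` (`H(X₃) ≅ H(A ∪ B)` for `A`, `B` open, via Prop. 2.21), and the vanishing
  criterion `isZero_mvX₂_homology` for the middle term; consequences `mvIso`
  (`Hⱼ₊₁(A ∪ B) ≅ Hⱼ(A ∩ B)` when `H` of `A`, `B` vanishes in degrees `j`, `j+1`) and `isZero_of_mv`;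
* `puncturedSuccIso : Hⱼ₊₁(ℝᵏ⁺¹ ∖ 0) ≅ Hⱼ(ℝᵏ ∖ 0)` (`j ≥ 1`) from the slit decomposition of
  `…PuncturedEuclidean`; **`isZero_homology_punctured`**: `Hⱼ(ℝᵏ ∖ 0) = 0` for `j ≥ k`, `j ≥ 1`;
* **`not_isZero_homology_punctured_two`**: `H₁(ℝ² ∖ 0; M) ≠ 0` (`M` nontrivial), by the explicit
  Mayer–Vietoris element `[(1,0)] - [(-1,0)]` and the half-plane counting functional `epsPos`;
  hence `not_isZero_homology_punctured` (`Hₘ(ℝᵐ⁺¹ ∖ 0) ≠ 0`) and, by the radial homotopy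
  equivalence, **`not_isZero_singularHomology_unitSphere`**: `Hₘ(Sᵐ; M) ≠ 0` for `m ≥ 1` for the
  unit sphere of `EuclideanSpace ℝ (Fin (m+1))` and Mathlib's singular homology (Cor. 2.14, the
  nonvanishing half).

**Part III — local homology `H(X | A)` (§3.3 p. 231): definitions, functoriality, excision, the
exact sequence of the pair.**

* `Literature.clocalHomology R M X A i := Hᵢ(C(X)/C(X ∖ A))` (`Literature.awaySub R M X A = C(X ∖ A)`; the `c`
  marks the concrete model, as in `csingularHomology` — `Literature.AlgebraicTopology.SingularHomology.localHomologyOfSet` of `…Orientation`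
  is the analogue over Mathlib's `relativeSingularHomology`), with
  functoriality `clocalHomology.map` in maps of pairs (`map_id`, `map_comp`, `map_congr`),
  restriction `res` (`B ⊆ A`; `res_self`, `res_comp_res`), homeomorphism invariance
  (`mapIsoOfHomeomorph`), **excision** `isIso_map_val` (`H(Ω | A) ≅ H(X | A)` for `A ⊆ Ω` closed,
  `Ω` open; Thm. 2.20 via Part I), the connecting map `δ : Hᵢ₊₁(X | A) ⟶ Hᵢ(C(X ∖ A))` of the pair
  with its naturality `δ_comp_incl` and `isIso_δ`, `isIso_homologyMap_incl_of_isIso` (nested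
  subspaces) and `isZero_empty` (`H(X | ∅) = 0`);
* `Literature.clocalHomology.PtDetermined R M X n A` — Hatcher's property `P(A)` from the proof of
  Lemma 3.27 (p. 236): `Hᵢ(X | A) = 0` for `i > n`, and a class of `Hₙ(X | A)` restricting to `0` in
  every `Hₙ(X | x)`, `x ∈ A`, is `0` (i.e. Lemma 3.27 (b) and the uniqueness half of (a)); its theory
  (closure under finite unions, the Euclidean and manifold cases) is in `…NoncompactManifoldProofs`.

Everything is proved; the published statements (Prop. 2.21, Thm. 2.20, Cor. 2.14, the definitions
of §3.3) carry `[cite: HatcherAT2002, …]`, the glue is [folklore]. Each part is a self-contained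
`noncomputable section` (its `universe`/`open`/`set_option` lines are scoped to it).

## References

* A. Hatcher, *Algebraic Topology*, CUP 2002, §2.1 Prop. 2.21, Thm. 2.20; §2.2 pp. 149–150;
  Cor. 2.14; §3.3 p. 231 (local homology), Lemma 3.27 (p. 236).
-/

noncomputable section

-- as in `SingularChainsConcrete`: chains of the concrete complex are `Finsupp`s up to unfolding
set_option backward.isDefEq.respectTransparency false

open CategoryTheory Limits

universe u v w t

namespace Literature.AlgebraicTopology.SingularHomology

/-! ### Adapters: `c.prev`/`c.next` versus explicit indices -/

section Adapters

variable {R : Type v} [CommRing R] {ι : Type t} {c : ComplexShape ι}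
variable {K : HomologicalComplex (ModuleCat.{w} R) c}

/-- Boundaries from `c.prev j` are boundaries from any `i` with `c.prev j = i`. [folklore] -/
lemma exists_d_prev_eq_iff {i j : ι} (h : c.prev j = i) (z : K.X j) :
    (∃ w : K.X (c.prev j), K.d (c.prev j) j w = z) ↔ ∃ w : K.X i, K.d i j w = z := by
  subst h
  rfl

/-- The cycle condition towards `c.next j` is the cycle condition towards any `k` with
`c.next j = k`. [folklore] -/
lemma d_next_eq_zero_iff {j k : ι} (h : c.next j = k) (z : K.X j) :
    K.d j (c.next j) z = 0 ↔ K.d j k z = 0 := by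
  subst h
  rfl

end Adapters

/-! ### The subcomplexes of chains in a subspace and of `𝒰`-small chains -/

section Subcomplexes

variable (R : Type v) [CommRing R] (M : Type v) [AddCommGroup M] [Module R M]
variable {X : Type u} [TopologicalSpace X]

/-- The differential of the concrete singular chain complex preserves a family of submodules that
is preserved by `bd`. [folklore] -/
lemma d_mem_of_bd_mem (N : (n : ℕ) → Submodule R (CChain M X n))
    (hN : ∀ (n : ℕ) (c : CChain M X (n + 1)), c ∈ N (n + 1) → csingularChainComplex.bd R n c ∈ N n)
    {i j : ℕ} {x : (csingularChainComplex R M X).X i} (hx : x ∈ N i) :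
    (csingularChainComplex R M X).d i j x ∈ N j := by
  by_cases hij : (ComplexShape.down ℕ).Rel i j
  · obtain rfl : j + 1 = i := hij
    rw [csingularChainComplex.d_apply]
    exact hN j x hx
  · rw [(csingularChainComplex R M X).shape i j hij]
    exact Submodule.zero_mem _

variable (X) in
/-- The subcomplex `C_•(A; M) ⊆ C_•(X; M)` of chains with image in `A` (Hatcher 2002, §2.1). [folklore] -/
def chainsInSub (A : Set X) : Subcomplex (csingularChainComplex R M X) where
  carrier n := chainsIn R M X A n
  d_mem' hx := d_mem_of_bd_mem R M (fun n => chainsIn R M X A n) (fun _ _ hc => bd_mem_chainsIn R M hc) hx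

/-- Membership in `chainsInSub`. [folklore] -/
@[simp]
lemma mem_chainsInSub_iff (A : Set X) (n : ℕ) (c : (csingularChainComplex R M X).X n) :
    c ∈ chainsInSub R M X A n ↔ c ∈ chainsIn R M X A n := Iff.rfl

/-- `chainsInSub` in a degree is `chainsIn`. [folklore] -/
lemma chainsInSub_apply (A : Set X) (n : ℕ) : chainsInSub R M X A n = chainsIn R M X A n := rfl

/-- `C(A) ≤ C(B)` for `A ⊆ B`. [folklore] -/
lemma chainsInSub_mono {A B : Set X} (h : A ⊆ B) : chainsInSub R M X A ≤ chainsInSub R M X B :=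
  fun n => chainsIn_mono R M h n

/-- `C(univ) = ⊤`. [folklore] -/
@[simp]
lemma chainsInSub_univ : chainsInSub R M X Set.univ = ⊤ :=
  Subcomplex.ext fun n => chainsIn_univ R M n

/-- `C(A ∩ B) = C(A) ⊓ C(B)` (Hatcher 2002, §2.2). [folklore] -/
lemma chainsInSub_inter (A B : Set X) :
    chainsInSub R M X (A ∩ B) = chainsInSub R M X A ⊓ chainsInSub R M X B :=
  Subcomplex.ext fun n => chainsIn_inter R M A B n

/-- `C(A) ⊔ C(B) ≤ C(A ∪ B)` (Hatcher 2002, §2.2: `C(A) + C(B) ⊆ C(A ∪ B)`). [folklore] -/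
lemma chainsInSub_sup_le (A B : Set X) :
    chainsInSub R M X A ⊔ chainsInSub R M X B ≤ chainsInSub R M X (A ∪ B) :=
  sup_le (chainsInSub_mono R M Set.subset_union_left) (chainsInSub_mono R M Set.subset_union_right)

variable (X) in
/-- The submodule of `𝒰`-small `n`-chains `Cₙ^𝒰(X; M) = ∑ᵢ Cₙ(Uᵢ; M)` for a family of subsets
`U` (Hatcher 2002, §2.1, Prop. 2.21). [folklore] -/
def smallChains {ι : Type*} (U : ι → Set X) (n : ℕ) : Submodule R (CChain M X n) :=
  ⨆ i, chainsIn R M X (U i) n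

/-- A linear map sending each `Cₙ(Uᵢ)` into `Cₘ(Uᵢ)` sends small chains to small chains. [folklore] -/
lemma map_mem_smallChains {ι : Type*} (U : ι → Set X) {n m : ℕ} (f : CChain M X n →ₗ[R] CChain M X m)
    (hf : ∀ i c, c ∈ chainsIn R M X (U i) n → f c ∈ chainsIn R M X (U i) m)
    {c : CChain M X n} (hc : c ∈ smallChains R M X U n) : f c ∈ smallChains R M X U m := by
  induction hc using Submodule.iSup_induction' with
  | mem i x hx => exact Submodule.mem_iSup_of_mem i (hf i x hx)
  | zero => rw [map_zero]; exact Submodule.zero_mem _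
  | add x y _ _ hx hy => rw [map_add]; exact Submodule.add_mem _ hx hy

/-- `∂` preserves small chains. [folklore] -/
lemma bd_mem_smallChains {ι : Type*} (U : ι → Set X) {n : ℕ} {c : CChain M X (n + 1)}
    (hc : c ∈ smallChains R M X U (n + 1)) : csingularChainComplex.bd R n c ∈ smallChains R M X U n :=
  map_mem_smallChains R M U _ (fun _ _ h => bd_mem_chainsIn R M h) hc

/-- `Sʲ` preserves small chains. [folklore] -/
lemma sdX_pow_mem_smallChains {ι : Type*} (U : ι → Set X) {n : ℕ} (j : ℕ) {c : CChain M X n}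
    (hc : c ∈ smallChains R M X U n) : ((sdX R M n) ^ j) c ∈ smallChains R M X U n :=
  map_mem_smallChains R M U _ (fun _ _ h => sdX_pow_mem_chainsIn j h) hc

/-- `Dⱼ` preserves small chains. [folklore] -/
lemma sdhSum_mem_smallChains {ι : Type*} (U : ι → Set X) {n : ℕ} (j : ℕ) {c : CChain M X n}
    (hc : c ∈ smallChains R M X U n) : sdhSum R M j n c ∈ smallChains R M X U (n + 1) :=
  map_mem_smallChains R M U _ (fun _ _ h => sdhSum_mem_chainsIn j h) hc

/-- If `Sʲ c` is small then so is `Sʲ⁺ˡ c`. [folklore] -/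
lemma sdX_pow_add_mem_smallChains {ι : Type*} (U : ι → Set X) {n : ℕ} {j : ℕ} (l : ℕ)
    {c : CChain M X n} (hc : ((sdX R M n) ^ j) c ∈ smallChains R M X U n) :
    ((sdX R M n) ^ (l + j)) c ∈ smallChains R M X U n := by
  rw [pow_add, Module.End.mul_apply]
  exact sdX_pow_mem_smallChains R M U l hc

/-- **Every chain in `⋃ U` becomes `𝒰`-small after iterated subdivision** (Hatcher 2002, §2.1,
proof of Prop. 2.21 (4)): for `U` an open family and `c` a chain with image in `⋃ᵢ Uᵢ`, some
`Sʲ c` lies in `∑ᵢ Cₙ(Uᵢ)`. [folklore] -/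
theorem exists_sdX_pow_mem_smallChains {ι : Type*} (U : ι → Set X) (hU : ∀ i, IsOpen (U i)) {n : ℕ}
    {c : CChain M X n} (hc : c ∈ chainsIn R M X (⋃ i, U i) n) :
    ∃ j : ℕ, ((sdX R M n) ^ j) c ∈ smallChains R M X U n := by
  classical
  -- one exponent per simplex of `c`, then the maximum
  have h1 : ∀ σ ∈ c.support, ∃ j : ℕ, ((sdX R M n) ^ j) (Finsupp.single σ (c σ)) ∈ smallChains R M X U n :=
    fun σ hσ => exists_sdX_pow_mem_iSup R M U hU σ ((mem_chainsIn_iff R M c).mp hc σ hσ) (c σ)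
  choose! j hj using h1
  refine ⟨c.support.sup j, ?_⟩
  generalize hJ : c.support.sup j = J
  have hle : ∀ σ ∈ c.support, j σ ≤ J := fun σ hσ => hJ ▸ Finset.le_sup (f := j) hσ
  rw [← Finsupp.sum_single c, Finsupp.sum, map_sum]
  refine Submodule.sum_mem _ fun σ hσ => ?_
  obtain ⟨l, hl⟩ := Nat.exists_eq_add_of_le (hle σ hσ)
  rw [hl, add_comm]
  exact sdX_pow_add_mem_smallChains R M U l (hj σ hσ)

variable (X) in
/-- The subcomplex `C_•^𝒰(X; M) = ∑ᵢ C_•(Uᵢ; M)` of `𝒰`-small chains (Hatcher 2002, Prop. 2.21). [folklore] -/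
def smallSub {ι : Type*} (U : ι → Set X) : Subcomplex (csingularChainComplex R M X) where
  carrier n := smallChains R M X U n
  d_mem' hx := d_mem_of_bd_mem R M (smallChains R M X U) (fun _ _ hc => bd_mem_smallChains R M U hc) hx

/-- `smallSub` in a degree is `smallChains`. [folklore] -/
lemma smallSub_apply {ι : Type*} (U : ι → Set X) (n : ℕ) : smallSub R M X U n = smallChains R M X U n :=
  rfl

/-- `C^𝒰 ≤ C(Y)` when every `Uᵢ ⊆ Y`. [folklore] -/
lemma smallSub_le_chainsInSub {ι : Type*} {U : ι → Set X} {Y : Set X} (h : ∀ i, U i ⊆ Y) :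
    smallSub R M X U ≤ chainsInSub R M X Y :=
  fun n => iSup_le fun i => chainsIn_mono R M (h i) n

/-- For two subsets, `C^{A,B} = C(A) ⊔ C(B)`. [folklore] -/
lemma smallSub_bool (A B : Set X) :
    smallSub R M X (fun b : Bool => cond b A B) = chainsInSub R M X A ⊔ chainsInSub R M X B :=
  Subcomplex.ext fun n => by
    change (⨆ b : Bool, chainsIn R M X (cond b A B) n) = chainsIn R M X A n ⊔ chainsIn R M X B n
    rw [iSup_bool_eq]
    rfl

end Subcomplexes

/-! ### Prop. 2.21: small chains compute homology -/

section SmallChainsTheorem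

variable (R : Type v) [CommRing R] (M : Type v) [AddCommGroup M] [Module R M]
variable {X : Type u} [TopologicalSpace X]

/-- The value of the differential of a subcomplex of the concrete singular chain complex, in
consecutive degrees, is `bd` of the value. [folklore] -/
lemma toComplex_d_val (S : Subcomplex (csingularChainComplex R M X)) (k : ℕ)
    (x : S.toComplex.X (k + 1)) :
    (S.toComplex.d (k + 1) k x).1 = csingularChainComplex.bd R k (x.1 : CChain M X (k + 1)) := by
  rw [Subcomplex.toComplex_d_apply_val, csingularChainComplex.d_apply]

/-- In degree `0` every chain of a subcomplex is a cycle (the target of `d` is `c.next 0`). [folklore] -/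
lemma toComplex_d_zero_next (S : Subcomplex (csingularChainComplex R M X)) (x : S.toComplex.X 0) :
    S.toComplex.d 0 ((ComplexShape.down ℕ).next 0) x = 0 := by
  rw [S.toComplex.shape 0 _ (by simp [ChainComplex.next_nat_zero])]
  rfl

/-- **Hatcher Prop. 2.21 (small chains compute homology).** Let `U` be a family of open subsets
of `X` and `Y` a subset with `Uᵢ ⊆ Y ⊆ ⋃ᵢ Uᵢ`. Then the inclusion of the complex of `𝒰`-small
chains `C^𝒰 = ∑ᵢ C(Uᵢ)` into the chains `C(Y)` with image in `Y` induces isomorphisms on all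
homology groups. Proof as in Hatcher: `Sʲ` and `Dⱼ = ∑_{i<j} T Sⁱ` with `∂Dⱼ + Dⱼ∂ = 𝟙 - Sʲ`, and
every chain becomes small after iterated subdivision. [cite: HatcherAT2002, Prop. 2.21] -/
theorem isIso_homologyMap_incl_smallSub {ι : Type*} (U : ι → Set X) (hU : ∀ i, IsOpen (U i))
    {Y : Set X} (hUY : ∀ i, U i ⊆ Y) (hYU : Y ⊆ ⋃ i, U i) (k : ℕ) :
    IsIso (HomologicalComplex.homologyMap
      (Subcomplex.incl (smallSub_le_chainsInSub R M hUY :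
        smallSub R M X U ≤ chainsInSub R M X Y)) k) := by
  have hsmall : ∀ {n : ℕ} (c : CChain M X n), c ∈ chainsIn R M X Y n →
      ∃ j : ℕ, ((sdX R M n) ^ j) c ∈ smallChains R M X U n := fun c hc =>
    exists_sdX_pow_mem_smallChains R M U hU (chainsIn_mono R M hYU _ hc)
  -- `∂ (Dⱼ z) = z - Sʲ z` for a cycle `z` (in every degree)
  have hD : ∀ (k j : ℕ) (zc : CChain M X k), (∀ k', k = k' + 1 → ∀ (h : k = k' + 1),
      csingularChainComplex.bd R k' (h ▸ zc) = 0) →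
      csingularChainComplex.bd R k (sdhSum R M j k zc) + ((sdX R M k) ^ j) zc = zc := by
    intro k j zc hzc
    cases k with
    | zero => rw [bd_sdhSum_zero, sdX_pow_zero_apply, zero_add]
    | succ k =>
      have h := bd_sdhSum_add_sdhSum_bd (R := R) (M := M) j zc
      rw [hzc k rfl rfl, map_zero, add_zero] at h
      rw [h, sub_add_cancel]
  rw [ConcreteCategory.isIso_iff_bijective]
  constructor
  · -- injectivity: a small cycle bounding in `C(Y)` bounds in `C^𝒰`
    refine (homologyMap_injective_iff _).mpr fun z hz hb => ?_
    rw [exists_d_prev_eq_iff (ChainComplex.prev ℕ k)] at hb ⊢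
    obtain ⟨w, hw⟩ := hb
    set zc : CChain M X k := z.1 with hzc
    set wc : CChain M X (k + 1) := w.1 with hwc
    have hw' : csingularChainComplex.bd R k wc = zc := by
      rw [hwc, hzc, ← toComplex_d_val, hw]
      rfl
    have hcyc : ∀ k', k = k' + 1 → ∀ (h : k = k' + 1), csingularChainComplex.bd R k' (h ▸ zc) = 0 := by
      rintro k' rfl h
      rw [d_next_eq_zero_iff (ChainComplex.next_nat_succ k')] at hz
      rw [hzc, ← toComplex_d_val, hz]
      rfl
    obtain ⟨j, hj⟩ := hsmall wc w.2
    refine ⟨⟨((sdX R M (k + 1)) ^ j) wc + sdhSum R M j k zc,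
      Submodule.add_mem _ hj (sdhSum_mem_smallChains R M U j z.2)⟩, Subtype.ext ?_⟩
    rw [toComplex_d_val]
    change csingularChainComplex.bd R k (((sdX R M (k + 1)) ^ j) wc + sdhSum R M j k zc) = zc
    rw [map_add, ← sdX_pow_bd, hw', add_comm, hD k j zc hcyc]
  · -- surjectivity: every cycle of `C(Y)` is homologous to a small cycle
    refine (homologyMap_surjective_iff _).mpr fun z hz => ?_
    set zc : CChain M X k := z.1 with hzc
    have hcyc : ∀ k', k = k' + 1 → ∀ (h : k = k' + 1), csingularChainComplex.bd R k' (h ▸ zc) = 0 := by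
      rintro k' rfl h
      rw [d_next_eq_zero_iff (ChainComplex.next_nat_succ k')] at hz
      rw [hzc, ← toComplex_d_val, hz]
      rfl
    obtain ⟨j, hj⟩ := hsmall zc z.2
    refine ⟨⟨((sdX R M k) ^ j) zc, hj⟩, ?_, ?_⟩
    · -- `Sʲ z` is a cycle
      cases k with
      | zero => exact toComplex_d_zero_next R M _ _
      | succ k =>
        rw [d_next_eq_zero_iff (ChainComplex.next_nat_succ k)]
        apply Subtype.ext
        rw [toComplex_d_val]
        change csingularChainComplex.bd R k (((sdX R M (k + 1)) ^ j) zc) = 0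
        rw [← sdX_pow_bd, hcyc k rfl rfl, map_zero]
    · rw [exists_d_prev_eq_iff (ChainComplex.prev ℕ k)]
      refine ⟨⟨sdhSum R M j k zc, sdhSum_mem_chainsIn j z.2⟩, Subtype.ext ?_⟩
      rw [toComplex_d_val]
      change csingularChainComplex.bd R k (sdhSum R M j k zc) = zc - ((sdX R M k) ^ j) zc
      rw [eq_sub_iff_add_eq, hD k j zc hcyc]

/-- The inclusion of equal subcomplexes is an isomorphism. [folklore] -/
lemma Subcomplex.isIso_incl_of_eq {R : Type v} [CommRing R] {ι' : Type t} {c : ComplexShape ι'}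
    {K : HomologicalComplex (ModuleCat.{w} R) c} {S T : Subcomplex K} (h : S = T) :
    IsIso (Subcomplex.incl h.le) := by
  subst h
  rw [Subcomplex.incl, Subcomplex.subMap_id]
  infer_instance

/-- **Prop. 2.21 for a cover of the whole space**: if the open sets `Uᵢ` cover `X`, the inclusion
`C^𝒰(X) ↪ C(X)` induces isomorphisms on homology. [cite: HatcherAT2002, Prop. 2.21] -/
theorem isIso_homologyMap_ι_smallSub {ι : Type*} (U : ι → Set X) (hU : ∀ i, IsOpen (U i))
    (hcover : (Set.univ : Set X) ⊆ ⋃ i, U i) (k : ℕ) :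
    IsIso (HomologicalComplex.homologyMap (smallSub R M X U).ι k) := by
  have h1 := isIso_homologyMap_incl_smallSub R M U hU (Y := Set.univ) (fun i => Set.subset_univ _)
    hcover k
  have h2 : IsIso (HomologicalComplex.homologyMap
      (Subcomplex.incl (chainsInSub_univ R M (X := X)).le) k) :=
    haveI := Subcomplex.isIso_incl_of_eq (chainsInSub_univ R M (X := X))
    inferInstance
  rw [← Subcomplex.incl_ι (smallSub_le_chainsInSub R M (U := U) (Y := Set.univ)
    fun i => Set.subset_univ _), ← Subcomplex.incl_ι (chainsInSub_univ R M (X := X)).le,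
    HomologicalComplex.homologyMap_comp, HomologicalComplex.homologyMap_comp]
  haveI := h1
  haveI := h2
  infer_instance

/-- **Prop. 2.21 for two open sets**: `C(A) + C(B) ↪ C(A ∪ B)` induces isomorphisms on homology
for `A`, `B` open (Hatcher 2002, Prop. 2.21 with `𝒰 = {A, B}`, the form used for excision and
Mayer–Vietoris). [cite: HatcherAT2002, Prop. 2.21] -/
theorem isIso_homologyMap_incl_sup {A B : Set X} (hA : IsOpen A) (hB : IsOpen B) (k : ℕ) :
    IsIso (HomologicalComplex.homologyMap (Subcomplex.incl (chainsInSub_sup_le R M A B)) k) := by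
  have hU : ∀ b : Bool, IsOpen (cond b A B) := fun b => by cases b <;> assumption
  have hUY : ∀ b : Bool, cond b A B ⊆ A ∪ B := fun b => by
    cases b
    · exact Set.subset_union_right
    · exact Set.subset_union_left
  have hYU : A ∪ B ⊆ ⋃ b : Bool, cond b A B := by
    rintro x (hx | hx)
    · exact Set.mem_iUnion.mpr ⟨true, hx⟩
    · exact Set.mem_iUnion.mpr ⟨false, hx⟩
  have h1 := isIso_homologyMap_incl_smallSub R M _ hU hUY hYU k
  haveI := Subcomplex.isIso_incl_of_eq (smallSub_bool R M A B (X := X)).symm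
  rw [show Subcomplex.incl (chainsInSub_sup_le R M A B) =
      Subcomplex.incl (smallSub_bool R M A B (X := X)).symm.le ≫
        Subcomplex.incl (smallSub_le_chainsInSub R M hUY) from
    (Subcomplex.incl_comp_incl _ _).symm, HomologicalComplex.homologyMap_comp]
  haveI := h1
  infer_instance

/-- **Prop. 2.21 for two open sets covering `X`**: `C(A) + C(B) ↪ C(X)` induces isomorphisms on
homology when `A ∪ B = X` (Hatcher 2002, Prop. 2.21; the input of the Mayer–Vietoris sequence,
p. 149). [cite: HatcherAT2002, Prop. 2.21] -/
theorem isIso_homologyMap_ι_sup {A B : Set X} (hA : IsOpen A) (hB : IsOpen B)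
    (hAB : A ∪ B = Set.univ) (k : ℕ) :
    IsIso (HomologicalComplex.homologyMap (chainsInSub R M X A ⊔ chainsInSub R M X B).ι k) := by
  have h1 := isIso_homologyMap_incl_sup R M hA hB k
  have heq : chainsInSub R M X (A ∪ B) = ⊤ := by rw [hAB, chainsInSub_univ]
  haveI := Subcomplex.isIso_incl_of_eq heq
  rw [← Subcomplex.incl_ι (chainsInSub_sup_le R M A B), ← Subcomplex.incl_ι heq.le,
    HomologicalComplex.homologyMap_comp, HomologicalComplex.homologyMap_comp]
  haveI := h1
  infer_instance

/-- **Excision (concrete form; Hatcher Thm. 2.20 via Prop. 2.21).** For open sets `Ω`, `C` with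
`Ω ∪ C = X`, the map of quotient complexes `C(Ω)/C(Ω ∩ C) ⟶ C(X)/C(C)` (with `C(Ω ∩ C)` realised as
the chains of `C(Ω)` lying in `C(C)`) induces isomorphisms on homology. With `C = X ∖ A` this is
`Hₖ(Ω, Ω ∖ A) ≅ Hₖ(X, X ∖ A)`. [cite: HatcherAT2002, Thm. 2.20] -/
theorem isIso_homologyMap_quotMap_excision {Ω C : Set X} (hΩ : IsOpen Ω) (hC : IsOpen C)
    (hΩC : Ω ∪ C = Set.univ) (k : ℕ) :
    IsIso (HomologicalComplex.homologyMap (Subcomplex.quotMap (chainsInSub R M X Ω).ι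
      ((chainsInSub R M X C).comap (chainsInSub R M X Ω).ι) (chainsInSub R M X C) le_rfl) k) := by
  refine Subcomplex.isIso_homologyMap_quotMap_of_sup _ _ k ?_ fun j _ => ?_
  · exact isIso_homologyMap_ι_sup R M hC hΩ ((Set.union_comm _ _).trans hΩC) k
  · haveI := isIso_homologyMap_ι_sup R M hC hΩ ((Set.union_comm _ _).trans hΩC) j
    infer_instance

end SmallChainsTheorem

/-! ### Chains of a subspace as a subcomplex -/

section Subspace

variable (R : Type v) [CommRing R] (M : Type v) [AddCommGroup M] [Module R M]
variable {X : Type u} [TopologicalSpace X]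

/-- The chain map `C(↥A) ⟶ C(X)` of the inclusion lands in the subcomplex `C(A)`. [folklore] -/
lemma map_val_mem_chainsInSub (A : Set X) (n : ℕ) (c : (csingularChainComplex R M A).X n) :
    (csingularChainComplex.map R M (⟨Subtype.val, continuous_subtype_val⟩ : C(A, X))).f n c ∈
      chainsInSub R M X A n := by
  rw [csingularChainComplex.map_f_apply, mem_chainsInSub_iff, ← range_lmapDomain_val]
  exact LinearMap.mem_range_self _ _

variable (X) in
/-- The chain map `C(↥A) ⟶ C(A)` (co-restriction of the inclusion) (Hatcher 2002, §2.1: chains of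
the subspace `A` "are" the chains of `X` with image in `A`). [folklore] -/
def subspaceLift (A : Set X) : csingularChainComplex R M A ⟶ (chainsInSub R M X A).toComplex :=
  (chainsInSub R M X A).lift (csingularChainComplex.map R M ⟨Subtype.val, continuous_subtype_val⟩)
    (map_val_mem_chainsInSub R M A)

/-- `subspaceLift ≫ ι = C(incl)`. [folklore] -/
@[reassoc (attr := simp)]
lemma subspaceLift_ι (A : Set X) :
    subspaceLift R M X A ≫ (chainsInSub R M X A).ι =
      csingularChainComplex.map R M ⟨Subtype.val, continuous_subtype_val⟩ :=
  Subcomplex.lift_ι _ _ _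

/-- **`C(↥A) ≅ C(A)`**: the co-restriction is an isomorphism of complexes (injective with image
`chainsIn A` degreewise). [folklore] -/
instance isIso_subspaceLift (A : Set X) : IsIso (subspaceLift R M X A) := by
  refine Subcomplex.isIso_lift _ _ _ (fun n => ?_) (fun n y hy => ?_)
  · intro x y hxy
    rw [csingularChainComplex.map_f_apply, csingularChainComplex.map_f_apply] at hxy
    exact mapDomain_val_injective (M := M) A n hxy
  · rw [mem_chainsInSub_iff, ← range_lmapDomain_val] at hy
    obtain ⟨x, rfl⟩ := hy
    exact ⟨x, rfl⟩

variable (X) in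
/-- The isomorphism of complexes `C(↥A) ≅ C(A)`. [folklore] -/
def subspaceIso (A : Set X) : csingularChainComplex R M A ≅ (chainsInSub R M X A).toComplex :=
  asIso (subspaceLift R M X A)

/-- Under `C(↥A) → C(X)`, the chains of `↥A` with image in `A ∩ B` (i.e. in `val ⁻¹' B`) are exactly
those mapping into `C(B)`. [folklore] -/
lemma chainsInSub_preimage_val (A B : Set X) :
    chainsInSub R M A (Subtype.val ⁻¹' B) =
      (chainsInSub R M X B).comap
        (csingularChainComplex.map R M (⟨Subtype.val, continuous_subtype_val⟩ : C(A, X))) := by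
  refine Subcomplex.ext fun n => Submodule.ext fun c => ?_
  rw [Subcomplex.mem_comap, mem_chainsInSub_iff, mem_chainsInSub_iff,
    csingularChainComplex.map_f_apply]
  constructor
  · intro hc
    exact mapDomain_mem_chainsIn R M _ (Set.mapsTo_preimage Subtype.val B) hc
  · intro hc
    rw [mem_chainsIn_iff] at hc ⊢
    intro τ hτ x hx
    have hτ' : τ.map ⟨Subtype.val, continuous_subtype_val⟩ ∈
        (Finsupp.mapDomain (fun σ : SingularSimplex A n => σ.map ⟨Subtype.val, continuous_subtype_val⟩)
          c).support := by
      rw [Finsupp.mem_support_iff, Finsupp.mapDomain_apply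
        (SingularSimplex.map_injective Subtype.val_injective), ← Finsupp.mem_support_iff]
      exact hτ
    have h := hc _ hτ'
    rw [SingularSimplex.range_map] at h
    exact h ⟨x, hx, rfl⟩

/-- The same, phrased with the co-restriction `subspaceLift`. [folklore] -/
lemma chainsInSub_preimage_val_eq_comap_lift (A B : Set X) :
    chainsInSub R M A (Subtype.val ⁻¹' B) =
      ((chainsInSub R M X B).comap (chainsInSub R M X A).ι).comap (subspaceLift R M X A) := by
  rw [← Subcomplex.comap_comp, subspaceLift_ι, chainsInSub_preimage_val]

end Subspace

end Literature.AlgebraicTopology.SingularHomology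

end

/-!
## Part II — Mayer–Vietoris (concrete form) and the homology of `ℝⁿ ∖ {0}` and of spheres

Hatcher 2002, §2.2 (pp. 149–150) and Cor. 2.14, for the punctured spaces `Literature.punctured n` of
`…PuncturedEuclidean`; see the module docstring.
-/

noncomputable section

-- as in `SingularChainsConcrete`: chains of the concrete complex are `Finsupp`s up to unfolding
set_option backward.isDefEq.respectTransparency false

open CategoryTheory Limits

universe u v

namespace Literature.AlgebraicTopology.SingularHomology

variable (R : Type v) [CommRing R] (M : Type v) [AddCommGroup M] [Module R M]

/-! ### Generalities -/

section General

variable {X : Type u} [TopologicalSpace X]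

/-- A space with no points has no singular simplices. [folklore] -/
instance SingularSimplex.isEmpty [IsEmpty X] (n : ℕ) : IsEmpty (SingularSimplex X n) :=
  ⟨fun σ => isEmptyElim (SingularSimplex.toContinuousMap σ (Classical.arbitrary _))⟩

/-- The singular homology of the empty space vanishes in every degree (Hatcher 2002, §2.1). [folklore] -/
theorem isZero_csingularHomology_of_isEmpty [IsEmpty X] (j : ℕ) : IsZero (csingularHomology R M X j) := by
  refine ShortComplex.isZero_homology_of_isZero_X₂ _ ?_
  change IsZero (ModuleCat.of R (CChain M X j))
  exact ModuleCat.isZero_of_subsingleton _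

variable (X) in
/-- `H(C(A)) ≅ H(↥A)`: the homology of the subcomplex of chains in `A` is the singular homology of
the subspace `A` (Hatcher 2002, §2.1). [folklore] -/
def homologySubIso (A : Set X) (j : ℕ) :
    (chainsInSub R M X A).toComplex.homology j ≅ csingularHomology R M A j :=
  ((HomologicalComplex.homologyFunctor _ _ j).mapIso (subspaceIso R M X A)).symm

/-- The homology of the subcomplex of equal subspaces agree (transport along an equality of
subcomplexes). [folklore] -/
def homologyInclIsoOfEq {S T : Subcomplex (csingularChainComplex R M X)} (h : S = T) (j : ℕ) :
    S.toComplex.homology j ≅ T.toComplex.homology j :=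
  haveI := Subcomplex.isIso_incl_of_eq h
  (HomologicalComplex.homologyFunctor _ _ j).mapIso (asIso (Subcomplex.incl h.le))

end General

/-! ### The Mayer–Vietoris sequence of two open sets, concrete form -/

section MayerVietoris

variable {X : Type u} [TopologicalSpace X] (A B : Set X)

variable (X) in
/-- The Mayer–Vietoris short exact sequence of complexes
`0 → C(A ∩ B) → C(A) ⊞ C(B) → C(A) + C(B) → 0` (Hatcher 2002, §2.2, p. 150), as the instance
`Subcomplex.mvSub (C(A)) (C(B))` of `Literature…ChainSubcomplex`. [folklore] -/
abbrev mvSES : ShortComplex (HomologicalComplex (ModuleCat.{max u v} R) (ComplexShape.down ℕ)) :=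
  Subcomplex.mvSub (chainsInSub R M X A) (chainsInSub R M X B)

/-- The Mayer–Vietoris sequence of complexes is short exact. [folklore] -/
lemma mvSES_shortExact : (mvSES R M X A B).ShortExact :=
  Subcomplex.mvSub_shortExact _ _

/-- The first term of Mayer–Vietoris computes `H(A ∩ B)` (Hatcher 2002, §2.2). [folklore] -/
def mvInterHomologyIso (j : ℕ) : (mvSES R M X A B).X₁.homology j ≅ csingularHomology R M ↥(A ∩ B) j :=
  homologyInclIsoOfEq R M (chainsInSub_inter R M A B).symm j ≪≫ homologySubIso R M X (A ∩ B) j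

/-- The middle term of Mayer–Vietoris has vanishing homology where `H(A)` and `H(B)` vanish. [folklore] -/
lemma isZero_mvX₂_homology (j : ℕ) (hA : IsZero (csingularHomology R M A j))
    (hB : IsZero (csingularHomology R M B j)) : IsZero ((mvSES R M X A B).X₂.homology j) :=
  isZero_homology_biprod _ _ j (hA.of_iso (homologySubIso R M X A j)) (hB.of_iso (homologySubIso R M X B j))

variable {A B}

/-- The third term of Mayer–Vietoris computes `H(A ∪ B)` when `A`, `B` are open (Hatcher 2002,
Prop. 2.21 / §2.2 p. 149: `H(C(A) + C(B)) ≅ H(A ∪ B)`). [folklore] -/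
def mvUnionHomologyIso (hA : IsOpen A) (hB : IsOpen B) (j : ℕ) :
    (mvSES R M X A B).X₃.homology j ≅ csingularHomology R M ↥(A ∪ B) j :=
  haveI := isIso_homologyMap_incl_sup R M hA hB j
  asIso (HomologicalComplex.homologyMap (Subcomplex.incl (chainsInSub_sup_le R M A B)) j) ≪≫
    homologySubIso R M X (A ∪ B) j

/-- **Mayer–Vietoris isomorphism**: for open `A`, `B` with `Hⱼ₊₁(A) = Hⱼ₊₁(B) = 0` and
`Hⱼ(A) = Hⱼ(B) = 0`, the connecting map gives `Hⱼ₊₁(A ∪ B) ≅ Hⱼ(A ∩ B)` (Hatcher 2002, §2.2,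
p. 149). [folklore] -/
def mvIso (hA : IsOpen A) (hB : IsOpen B) (j : ℕ)
    (hA1 : IsZero (csingularHomology R M A (j + 1))) (hB1 : IsZero (csingularHomology R M B (j + 1)))
    (hA0 : IsZero (csingularHomology R M A j)) (hB0 : IsZero (csingularHomology R M B j)) :
    csingularHomology R M ↥(A ∪ B) (j + 1) ≅ csingularHomology R M ↥(A ∩ B) j :=
  (mvUnionHomologyIso R M hA hB (j + 1)).symm ≪≫
    (mvSES_shortExact R M A B).δIso (j + 1) j rfl (isZero_mvX₂_homology R M A B _ hA1 hB1)
      (isZero_mvX₂_homology R M A B _ hA0 hB0) ≪≫ mvInterHomologyIso R M A B j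

/-- **Mayer–Vietoris vanishing**: for open `A`, `B` with `Hⱼ₊₁(A) = Hⱼ₊₁(B) = 0` and `Hⱼ(A ∩ B) = 0`,
`Hⱼ₊₁(A ∪ B) = 0` (the connecting map is injective) (Hatcher 2002, §2.2). [folklore] -/
theorem isZero_of_mv (hA : IsOpen A) (hB : IsOpen B) (j : ℕ)
    (hA1 : IsZero (csingularHomology R M A (j + 1))) (hB1 : IsZero (csingularHomology R M B (j + 1)))
    (hAB : IsZero (csingularHomology R M ↥(A ∩ B) j)) : IsZero (csingularHomology R M ↥(A ∪ B) (j + 1)) := by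
  have hmono := (mvSES_shortExact R M A B).mono_δ (j + 1) j rfl (isZero_mvX₂_homology R M A B _ hA1 hB1)
  have hz : IsZero ((mvSES R M X A B).X₁.homology j) := hAB.of_iso (mvInterHomologyIso R M A B j)
  have h3 : IsZero ((mvSES R M X A B).X₃.homology (j + 1)) :=
    IsZero.of_mono ((mvSES_shortExact R M A B).δ (j + 1) j rfl) hz
  exact h3.of_iso (mvUnionHomologyIso R M hA hB (j + 1)).symm

end MayerVietoris

/-! ### The homology of `ℝⁿ ∖ {0}` -/

section Punctured

/-- `ℝ⁰ ∖ {0}` is empty. [folklore] -/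
instance isEmpty_punctured_zero : IsEmpty ↥(punctured 0) :=
  ⟨fun v => v.2 (Subsingleton.elim _ _)⟩

/-- `H(ℝ⁰ ∖ {0}) = 0`. [folklore] -/
theorem isZero_homology_punctured_zero (j : ℕ) : IsZero (csingularHomology R M ↥(punctured 0) j) :=
  isZero_csingularHomology_of_isEmpty R M j

variable (k : ℕ)

/-- `H(A ∪ B) ≅ H(ℝᵏ⁺¹ ∖ {0})` for the slit decomposition (equality of subspaces). [folklore] -/
def unionSlitIso (j : ℕ) :
    csingularHomology R M ↥(slitUp k ∪ slitDown k) j ≅ csingularHomology R M ↥(punctured (k + 1)) j :=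
  csingularHomology.mapIso R M (Homeomorph.setCongr (slitUp_union_slitDown k)) j

/-- `H(A ∩ B) ≅ H(ℝᵏ ∖ {0})` for the slit decomposition (homotopy invariance). [folklore] -/
def interSlitIso (j : ℕ) :
    csingularHomology R M ↥(slitUp k ∩ slitDown k) j ≅ csingularHomology R M ↥(punctured k) j :=
  csingularHomology.isoOfHomotopyEquiv R M (slitInterHomotopyEquiv k) j

/-- The slit sets have vanishing positive-degree homology (contractible). [folklore] -/
lemma isZero_homology_slitUp {j : ℕ} (hj : j ≠ 0) : IsZero (csingularHomology R M ↥(slitUp k) j) :=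
  haveI := contractibleSpace_slitUp k
  isZero_csingularHomology_of_contractibleSpace R M hj

/-- The slit sets have vanishing positive-degree homology (contractible). [folklore] -/
lemma isZero_homology_slitDown {j : ℕ} (hj : j ≠ 0) : IsZero (csingularHomology R M ↥(slitDown k) j) :=
  haveI := contractibleSpace_slitDown k
  isZero_csingularHomology_of_contractibleSpace R M hj

/-- **`Hⱼ₊₁(ℝᵏ⁺¹ ∖ {0}) ≅ Hⱼ(ℝᵏ ∖ {0})` for `j ≥ 1`** (Mayer–Vietoris for the slit decomposition;
Hatcher 2002, §2.2, the computation behind Cor. 2.14 / Ex. 2.18 in the model `ℝⁿ ∖ {0} ≃ Sⁿ⁻¹`). [folklore] -/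
def puncturedSuccIso (j : ℕ) (hj : 1 ≤ j) :
    csingularHomology R M ↥(punctured (k + 1)) (j + 1) ≅ csingularHomology R M ↥(punctured k) j :=
  (unionSlitIso R M k (j + 1)).symm ≪≫
    mvIso R M (isOpen_slitUp k) (isOpen_slitDown k) j
      (isZero_homology_slitUp R M k (Nat.succ_ne_zero j)) (isZero_homology_slitDown R M k (Nat.succ_ne_zero j))
      (isZero_homology_slitUp R M k (by omega)) (isZero_homology_slitDown R M k (by omega)) ≪≫
    interSlitIso R M k j

/-- **`Hⱼ(ℝᵏ ∖ {0}) = 0` for `j ≥ k`, `j ≥ 1`** (Hatcher 2002, Cor. 2.14 / Ex. 2.18 in the model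
`ℝᵏ ∖ {0} ≃ Sᵏ⁻¹`: `Hⱼ(Sᵏ⁻¹) = 0` for `j ≥ k`). [folklore] -/
theorem isZero_homology_punctured : ∀ (k j : ℕ), k ≤ j → 1 ≤ j →
    IsZero (csingularHomology R M ↥(punctured k) j)
  | 0, j, _, _ => isZero_homology_punctured_zero R M j
  | k + 1, 0, _, h => absurd h (by omega)
  | k + 1, 1, hk, _ => by
    obtain rfl : k = 0 := by omega
    refine (isZero_of_mv R M (isOpen_slitUp 0) (isOpen_slitDown 0) 0
      (isZero_homology_slitUp R M 0 one_ne_zero) (isZero_homology_slitDown R M 0 one_ne_zero) ?_).of_iso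
      (unionSlitIso R M 0 1).symm
    exact (isZero_homology_punctured_zero R M 0).of_iso (interSlitIso R M 0 0)
  | k + 1, j + 2, hk, _ =>
    (isZero_homology_punctured k (j + 1) (by omega) (by omega)).of_iso (puncturedSuccIso R M k (j + 1) (by omega))

end Punctured

/-! ### `H₁(ℝ² ∖ {0}) ≠ 0` and the top homology of `ℝⁿ ∖ {0}` and of spheres -/

section NonVanishing

open SingularSimplex

variable {X : Type u} [TopologicalSpace X]

/-- The singular `0`-simplex at a point. [folklore] -/
def SingularSimplex.ofPoint (x : X) : SingularSimplex X 0 :=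
  toContinuousMap.symm (ContinuousMap.const _ x)

/-- The point of a singular `0`-simplex (`Δ⁰` is a single point). [folklore] -/
def SingularSimplex.pt (ρ : SingularSimplex X 0) : X := toContinuousMap ρ default

omit R M in
/-- The point of the `0`-simplex at `x` is `x`. [folklore] -/
@[simp]
lemma SingularSimplex.pt_ofPoint (x : X) : (ofPoint x).pt = x := by
  simp [pt, ofPoint]

omit R M in
/-- The point of a `0`-simplex lies in its image. [folklore] -/
lemma SingularSimplex.pt_mem_range (ρ : SingularSimplex X 0) : ρ.pt ∈ ρ.range := ⟨default, rfl⟩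

omit R M in
/-- The image of the `0`-simplex at `x` is `{x}`. [folklore] -/
lemma SingularSimplex.range_ofPoint (x : X) : (ofPoint x).range = {x} := by
  rw [SingularSimplex.range, ofPoint, Equiv.apply_symm_apply]
  exact Set.range_const

variable {n : ℕ}

/-- The straight singular `1`-simplex from `a` to `b` in `ℝⁿ`: `t ↦ t₀ a + t₁ b`
(Hatcher 2002, §2.1, linear `1`-simplices). [folklore] -/
def line (a b : RVec n) : SingularSimplex (RVec n) 1 :=
  toContinuousMap.symm ⟨fun t => (t.1 0) • a + (t.1 1) • b,
    (((continuous_apply 0).comp continuous_subtype_val).smul continuous_const).add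
      (((continuous_apply 1).comp continuous_subtype_val).smul continuous_const)⟩

omit R M in
/-- The value of `line a b`. [folklore] -/
lemma line_apply (a b : RVec n) (t : StdSimplex 1) :
    toContinuousMap (line a b) t = (t 0) • a + (t 1) • b := by
  rw [line, Equiv.apply_symm_apply]
  rfl

omit R M in
/-- The image of `line a b` is contained in the segment `[a, b]`. [folklore] -/
lemma range_line_subset (a b : RVec n) : (line a b).range ⊆ segment ℝ a b := by
  rintro _ ⟨t, rfl⟩
  rw [line_apply]
  exact ⟨t 0, t 1, t.2.1 0, t.2.1 1, stdSimplex.add_eq_one t, rfl⟩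

omit R M in
/-- The end point of `line a b` is `b`: `(line a b) ∘ δ₀ = [b]`. [folklore] -/
lemma line_face_zero (a b : RVec n) : (line a b).face 0 = ofPoint b := by
  apply toContinuousMap_injective
  ext t : 1
  rw [face_eq_compose, toContinuousMap_compose, ContinuousMap.comp_apply, StdSimplex.affMap_apply,
    line_apply]
  simp [StdSimplex.affComb_apply, ofPoint]

omit R M in
/-- The starting point of `line a b` is `a`: `(line a b) ∘ δ₁ = [a]`. [folklore] -/
lemma line_face_one (a b : RVec n) : (line a b).face 1 = ofPoint a := by
  apply toContinuousMap_injective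
  ext t : 1
  rw [face_eq_compose, toContinuousMap_compose, ContinuousMap.comp_apply, StdSimplex.affMap_apply,
    line_apply]
  simp [StdSimplex.affComb_apply, ofPoint]

/-- `∂ (m • [a, b]) = m • [b] - m • [a]` (Hatcher 2002, §2.1). [folklore] -/
lemma bd_single_line (a b : RVec n) (m : M) :
    csingularChainComplex.bd R 0 (Finsupp.single (line a b) m) =
      Finsupp.single (ofPoint b) m - Finsupp.single (ofPoint a) m := by
  rw [csingularChainComplex.bd_single, Fin.sum_univ_two, line_face_zero, line_face_one]
  simp [sub_eq_add_neg]

/-- The augmentation counting the coefficients of `0`-simplices in the open right half-plane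
`{v₀ > 0}` of `ℝ²` (a "local degree" functional). [folklore] -/
def epsPos : CChain M (RVec 2) 0 →ₗ[R] M :=
  Finsupp.lsum R fun ρ => if 0 < ρ.pt 0 then LinearMap.id else 0

/-- `epsPos` on an elementary `0`-chain. [folklore] -/
lemma epsPos_single (ρ : SingularSimplex (RVec 2) 0) (m : M) :
    epsPos R M (Finsupp.single ρ m) = if 0 < ρ.pt 0 then m else 0 := by
  rw [epsPos]
  erw [Finsupp.lsum_single]
  split_ifs <;> rfl

/-- The boundary of a `1`-simplex avoiding the vertical axis has both end points on the same side,
so `epsPos` of it vanishes (connectedness of `Δ¹`). [folklore] -/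
lemma epsPos_bd_single (τ : SingularSimplex (RVec 2) 1) (hτ : τ.range ⊆ {v | v 0 ≠ 0}) (m : M) :
    epsPos R M (csingularChainComplex.bd R 0 (Finsupp.single τ m)) = 0 := by
  have hconn : _root_.IsPreconnected τ.range := isPreconnected_range (toContinuousMap τ).continuous
  have hopen1 : IsOpen {v : RVec 2 | 0 < v 0} := isOpen_lt continuous_const (continuous_apply 0)
  have hopen2 : IsOpen {v : RVec 2 | v 0 < 0} := isOpen_lt (continuous_apply 0) continuous_const
  have hdisj : Disjoint {v : RVec 2 | 0 < v 0} {v : RVec 2 | v 0 < 0} :=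
    Set.disjoint_left.mpr fun v (h1 : 0 < v 0) (h2 : v 0 < 0) => lt_asymm h1 h2
  have hcover : τ.range ⊆ {v : RVec 2 | 0 < v 0} ∪ {v : RVec 2 | v 0 < 0} := fun v hv =>
    (lt_or_gt_of_ne (hτ hv)).symm.imp id id
  have h0 : (τ.face 0).pt ∈ τ.range := range_face_subset 0 τ (pt_mem_range _)
  have h1 : (τ.face 1).pt ∈ τ.range := range_face_subset 1 τ (pt_mem_range _)
  rw [csingularChainComplex.bd_single, Fin.sum_univ_two, map_add]
  simp only [Fin.val_zero, pow_zero, one_smul, Fin.val_one, pow_one, neg_smul, one_smul, map_neg,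
    epsPos_single]
  rcases hconn.subset_or_subset hopen1 hopen2 hdisj hcover with h | h
  · have e0 : 0 < (τ.face 0).pt 0 := h h0
    have e1 : 0 < (τ.face 1).pt 0 := h h1
    rw [if_pos e0, if_pos e1, add_neg_cancel]
  · have e0 : (τ.face 0).pt 0 < 0 := h h0
    have e1 : (τ.face 1).pt 0 < 0 := h h1
    rw [if_neg (lt_asymm e0), if_neg (lt_asymm e1), neg_zero, add_zero]

/-- `epsPos ∘ ∂ = 0` on `1`-chains avoiding the vertical axis. [folklore] -/
lemma epsPos_bd {w : CChain M (RVec 2) 1} (hw : w ∈ chainsIn R M (RVec 2) {v | v 0 ≠ 0} 1) :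
    epsPos R M (csingularChainComplex.bd R 0 w) = 0 := by
  rw [← Finsupp.sum_single w, Finsupp.sum, map_sum, map_sum]
  refine Finset.sum_eq_zero fun τ hτ => epsPos_bd_single R M τ ((mem_chainsIn_iff R M w).mp hw τ hτ) _

/-- The point `(1, 0) ∈ ℝ²`. [folklore] -/
def ptE : RVec 2 := ![1, 0]

/-- The point `(-1, 0) ∈ ℝ²`. [folklore] -/
def ptW : RVec 2 := ![-1, 0]

omit R M in
/-- For `v ∈ ℝ²`, `Fin.init v ≠ 0 ↔ v₀ ≠ 0`. [folklore] -/
lemma init_ne_zero_iff (v : RVec 2) : Fin.init v ≠ 0 ↔ v 0 ≠ 0 := by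
  rw [Ne, Ne, not_iff_not, funext_iff]
  simp [Fin.init, Fin.forall_fin_one]

omit R M in
/-- `A ∩ B ⊆ {v₀ ≠ 0}` (in fact equal) for the slit decomposition of `ℝ² ∖ {0}`. [folklore] -/
lemma slitInter_one_subset : slitUp 1 ∩ slitDown 1 ⊆ {v : RVec 2 | v 0 ≠ 0} := by
  rw [slitUp_inter_slitDown]
  exact fun v hv => (init_ne_zero_iff v).mp hv

omit R M in
/-- `(±1, 0) ∈ A ∩ B`. [folklore] -/
lemma ptE_mem : ptE ∈ slitUp 1 ∩ slitDown 1 ∧ ptW ∈ slitUp 1 ∩ slitDown 1 := by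
  rw [slitUp_inter_slitDown]
  constructor <;> simp [init_ne_zero_iff, ptE, ptW]

/-- In a star-shaped open set containing `p` and `q`, `m • [p] - m • [q]` is the boundary of the
chain `m • [r, p] - m • [r, q]` through the star centre `r`. [folklore] -/
lemma exists_bd_eq_of_starConvex {A : Set (RVec 2)} {r : RVec 2} (hA : StarConvex ℝ r A) {p q : RVec 2}
    (hp : p ∈ A) (hq : q ∈ A) (m : M) :
    ∃ w : CChain M (RVec 2) 1, w ∈ chainsIn R M (RVec 2) A 1 ∧
      csingularChainComplex.bd R 0 w = Finsupp.single (ofPoint p) m - Finsupp.single (ofPoint q) m := by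
  refine ⟨Finsupp.single (line r p) m - Finsupp.single (line r q) m, Submodule.sub_mem _
    (single_mem_chainsIn R M ((range_line_subset r p).trans (hA.segment_subset hp)) m)
    (single_mem_chainsIn R M ((range_line_subset r q).trans (hA.segment_subset hq)) m), ?_⟩
  rw [map_sub, bd_single_line, bd_single_line]
  abel

/-- **`H₁(ℝ² ∖ {0}; M) ≠ 0`** for a nontrivial coefficient module (Hatcher 2002, §2.2 / Cor. 2.14 for
`S¹`): in the Mayer–Vietoris sequence of the slit decomposition, `[(1,0)] - [(-1,0)] ∈ H₀(A ∩ B)`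
dies in `H₀(A) ⊕ H₀(B)` (paths through `(0, ±1)`) hence comes from `H₁(ℝ² ∖ 0)`, but is nonzero
(the half-plane count `epsPos` is invariant on boundaries and equals `m ≠ 0` on it). [folklore] -/
theorem not_isZero_homology_punctured_two [Nontrivial M] :
    ¬ IsZero (csingularHomology R M ↥(punctured 2) 1) := by
  obtain ⟨m₀, hm₀⟩ := exists_ne (0 : M)
  intro hZ
  set A : Set (RVec 2) := slitUp 1 with hAdef
  set B : Set (RVec 2) := slitDown 1 with hBdef
  have hZ3 : IsZero ((mvSES R M (RVec 2) A B).X₃.homology 1) :=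
    hZ.of_iso (mvUnionHomologyIso R M (isOpen_slitUp 1) (isOpen_slitDown 1) 1 ≪≫ unionSlitIso R M 1 1)
  set S := chainsInSub R M (RVec 2) A with hSdef
  set T := chainsInSub R M (RVec 2) B with hTdef
  -- the `0`-cycle `[p] - [q]` of `C(A ∩ B) = S ⊓ T`
  set c₀ : CChain M (RVec 2) 0 :=
    Finsupp.single (ofPoint ptE) m₀ - Finsupp.single (ofPoint ptW) m₀ with hc₀
  have hc₀mem : c₀ ∈ (S ⊓ T) 0 := by
    rw [hSdef, hTdef, ← chainsInSub_inter, mem_chainsInSub_iff]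
    refine Submodule.sub_mem _ (single_mem_chainsIn R M ?_ _) (single_mem_chainsIn R M ?_ _)
    · rw [range_ofPoint, Set.singleton_subset_iff]; exact ptE_mem.1
    · rw [range_ofPoint, Set.singleton_subset_iff]; exact ptE_mem.2
  set z : (S ⊓ T).toComplex.X 0 := ⟨c₀, hc₀mem⟩ with hzdef
  have hz : (S ⊓ T).toComplex.d 0 ((ComplexShape.down ℕ).next 0) z = 0 := toComplex_d_zero_next R M _ _
  set x : (S ⊓ T).toComplex.homology 0 := homologyCls z hz with hxdef
  -- (i) `x ↦ 0` in `H₀(A) ⊕ H₀(B)`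
  have hvanish : ∀ (U : Subcomplex (csingularChainComplex R M (RVec 2))) (hle : S ⊓ T ≤ U)
      (C : Set (RVec 2)) (hU : U = chainsInSub R M (RVec 2) C) (r : RVec 2) (hC : StarConvex ℝ r C)
      (hp : ptE ∈ C) (hq : ptW ∈ C),
      HomologicalComplex.homologyMap (Subcomplex.incl hle) 0 x = 0 := by
    intro U hle C hU r hC hp hq
    subst hU
    obtain ⟨w, hw, hbd⟩ := exists_bd_eq_of_starConvex R M hC hp hq m₀
    rw [hxdef, homologyMap_homologyCls, homologyCls_eq_zero_iff,
      exists_d_prev_eq_iff (ChainComplex.prev ℕ 0)]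
    refine ⟨⟨w, hw⟩, Subtype.ext ?_⟩
    rw [toComplex_d_val]
    exact hbd
  have hfx : HomologicalComplex.homologyMap (mvSES R M (RVec 2) A B).f 0 x = 0 := by
    change HomologicalComplex.homologyMap (Subcomplex.mvSubF S T) 0 x = 0
    rw [homologyMap_lift_eq_zero_iff]
    exact ⟨hvanish S inf_le_left A rfl (northPt 1) (starConvex_slitUp 1) ptE_mem.1.1 ptE_mem.2.1,
      hvanish T inf_le_right B rfl (southPt 1) (starConvex_slitDown 1) ptE_mem.1.2 ptE_mem.2.2⟩
  -- (ii) exactness: `x = δ y` for some `y ∈ H₁(A ∪ B) = 0`, so `x = 0`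
  have hex := (mvSES_shortExact R M A B).homology_exact₁ 1 0 rfl
  rw [ShortComplex.moduleCat_exact_iff] at hex
  obtain ⟨y, hy⟩ := hex x hfx
  have hx0 : x = 0 := by
    haveI := ModuleCat.subsingleton_of_isZero hZ3
    rw [← hy, Subsingleton.elim y 0, map_zero]
  -- (iii) but `x ≠ 0`: `epsPos` kills boundaries of chains in `A ∩ B` and `epsPos c₀ = m₀ ≠ 0`
  rw [hxdef, homologyCls_eq_zero_iff, exists_d_prev_eq_iff (ChainComplex.prev ℕ 0)] at hx0
  obtain ⟨⟨wc, hwc⟩, hw⟩ := hx0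
  have hw' : csingularChainComplex.bd R 0 (wc : CChain M (RVec 2) 1) = c₀ := by
    have h := congrArg Subtype.val hw
    rw [toComplex_d_val] at h
    exact h
  have hwmem : (wc : CChain M (RVec 2) 1) ∈ chainsIn R M (RVec 2) {v | v 0 ≠ 0} 1 := by
    rw [hSdef, hTdef, ← chainsInSub_inter] at hwc
    exact chainsIn_mono R M slitInter_one_subset 1 hwc
  have key := epsPos_bd R M hwmem
  rw [hw', hc₀, map_sub, epsPos_single, epsPos_single, pt_ofPoint, pt_ofPoint] at key
  norm_num [ptE, ptW] at key
  exact hm₀ key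

/-- **`Hₘ(ℝᵐ⁺¹ ∖ {0}; M) ≠ 0` for `m ≥ 1`** and `M` nontrivial (Hatcher 2002, Cor. 2.14 in the model
`ℝᵐ⁺¹ ∖ {0} ≃ Sᵐ`: `Hₘ(Sᵐ) ≅ M`). [folklore] -/
theorem not_isZero_homology_punctured [Nontrivial M] :
    ∀ (m : ℕ), 1 ≤ m → ¬ IsZero (csingularHomology R M ↥(punctured (m + 1)) m)
  | 0, h => absurd h (by omega)
  | 1, _ => not_isZero_homology_punctured_two R M
  | m + 2, _ => fun hZ => not_isZero_homology_punctured (m + 1) (by omega)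
      (hZ.of_iso (puncturedSuccIso R M (m + 2) (m + 1) (by omega)).symm)

/-- **The top homology of a sphere is nonzero**: `Hₘ(Sᵐ; M) ≠ 0` for `m ≥ 1`, `M` nontrivial, where
`Sᵐ` is the unit sphere of `EuclideanSpace ℝ (Fin (m + 1))` (Hatcher 2002, Cor. 2.14), in the
concrete model. [cite: HatcherAT2002, Cor. 2.14] -/
theorem not_isZero_csingularHomology_unitSphere [Nontrivial M] (m : ℕ) (hm : 1 ≤ m) :
    ¬ IsZero (csingularHomology R M ↥(unitSphere (m + 1)) m) := fun hZ =>
  not_isZero_homology_punctured R M m hm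
    (hZ.of_iso (csingularHomology.isoOfHomotopyEquiv R M (sphereHomotopyEquivPunctured (m + 1)) m).symm)

/-- **The top homology of a sphere is nonzero** for Mathlib's singular homology
`Literature.AlgebraicTopology.SingularHomology.singularHomology`: `Hₘ(Sᵐ; M) ≠ 0` for `m ≥ 1` and `M` nontrivial (Hatcher 2002, Cor. 2.14). [cite: HatcherAT2002, Cor. 2.14] -/
theorem not_isZero_singularHomology_unitSphere [Nontrivial M] (m : ℕ) (hm : 1 ≤ m) :
    ¬ IsZero (singularHomology R M ↥(unitSphere (m + 1)) m) := fun hZ =>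
  not_isZero_csingularHomology_unitSphere R M m hm (hZ.of_iso (csingularHomology.compIso R M _ m))

end NonVanishing

end Literature.AlgebraicTopology.SingularHomology

end

/-!
## Part III — local homology `H(X | A) = H(X, X ∖ A)`: definitions, functoriality, excision, the exact sequence of the pair

Hatcher 2002, §3.3 p. 231, in the concrete model, on top of Parts I–II; see the module docstring.
The theory of `PtDetermined` (Lemma 3.27) and Prop. 3.29 are in `…NoncompactManifoldProofs`.
-/

noncomputable section

-- as in `SingularChainsConcrete`: chains of the concrete complex are `Finsupp`s up to unfolding
set_option backward.isDefEq.respectTransparency false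

open CategoryTheory Limits

universe u v w

namespace Literature.AlgebraicTopology.SingularHomology

variable (R : Type v) [CommRing R] (M : Type v) [AddCommGroup M] [Module R M]
variable {X Y Z : Type u} [TopologicalSpace X] [TopologicalSpace Y] [TopologicalSpace Z]

/-! ### `H(X | A)`: definition and functoriality in maps of pairs -/

variable (X) in
/-- The subcomplex `C(X ∖ A) ⊆ C(X)` of chains avoiding `A` (Hatcher 2002, §3.3, the pair
`(X, X - A)`). [folklore] -/
abbrev awaySub (A : Set X) : Subcomplex (csingularChainComplex R M X) := chainsInSub R M X Aᶜ

variable (X) in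
/-- **Local homology** `Hᵢ(X | A; M) := Hᵢ(X, X ∖ A; M)`, the homology of `C(X)/C(X ∖ A)`
(Hatcher 2002, §3.3, p. 231: "local homology of `X` at `A`"), in the concrete chain model (the
prefix `c` as in `csingularHomology`; `Literature.AlgebraicTopology.SingularHomology.localHomologyOfSet`/`Literature.AlgebraicTopology.SingularHomology.localHomology` of `…Orientation`
are the analogues over Mathlib's `relativeSingularHomology`, at a set / at a point).
[cite: HatcherAT2002, §3.3 p. 231] -/
abbrev clocalHomology (A : Set X) (i : ℕ) : ModuleCat.{max u v} R := (awaySub R M X A).quotient.homology i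

namespace clocalHomology

/-- A continuous map with `f(X ∖ A) ⊆ Y ∖ B` sends chains avoiding `A` to chains avoiding `B`. [folklore] -/
lemma awaySub_le_comap {A : Set X} {B : Set Y} (f : C(X, Y)) (h : Set.MapsTo f Aᶜ Bᶜ) :
    awaySub R M X A ≤ (awaySub R M Y B).comap (csingularChainComplex.map R M f) := by
  intro n c hc
  rw [Subcomplex.mem_comap, csingularChainComplex.map_f_apply]
  exact mapDomain_mem_chainsIn R M f h hc

/-- The chain map `C(X)/C(X ∖ A) ⟶ C(Y)/C(Y ∖ B)` of a map of pairs `f : (X, X ∖ A) → (Y, Y ∖ B)`. [folklore] -/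
abbrev quotChainMap {A : Set X} {B : Set Y} (f : C(X, Y)) (h : Set.MapsTo f Aᶜ Bᶜ) :
    (awaySub R M X A).quotient ⟶ (awaySub R M Y B).quotient :=
  Subcomplex.quotMap (csingularChainComplex.map R M f) (awaySub R M X A) (awaySub R M Y B)
    (awaySub_le_comap R M f h)

/-- The induced map `f_* : Hᵢ(X | A) ⟶ Hᵢ(Y | B)` of a map of pairs `f : (X, X ∖ A) → (Y, Y ∖ B)`
(Hatcher 2002, §2.1 maps of pairs / §3.3). [folklore] -/
def map {A : Set X} {B : Set Y} (f : C(X, Y)) (h : Set.MapsTo f Aᶜ Bᶜ) (i : ℕ) :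
    clocalHomology R M X A i ⟶ clocalHomology R M Y B i :=
  HomologicalComplex.homologyMap (quotChainMap R M f h) i

/-- `𝟙_* = 𝟙`. [folklore] -/
@[simp]
lemma map_id (A : Set X) (h : Set.MapsTo (ContinuousMap.id X) Aᶜ Aᶜ) (i : ℕ) :
    map R M (ContinuousMap.id X) h i = 𝟙 _ := by
  have e := Subcomplex.quotMap_congr (S := awaySub R M X A) (T := awaySub R M X A)
    (csingularChainComplex.map_id (R := R) (M := M) (X := X)) (awaySub_le_comap R M _ h)
    (fun _ _ hc => hc)
  rw [map, quotChainMap, e, Subcomplex.quotMap_id, HomologicalComplex.homologyMap_id]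

/-- `(g ∘ f)_* = g_* ∘ f_*`. [folklore] -/
@[reassoc]
lemma map_comp {A : Set X} {B : Set Y} {C : Set Z} (f : C(X, Y)) (g : C(Y, Z))
    (hf : Set.MapsTo f Aᶜ Bᶜ) (hg : Set.MapsTo g Bᶜ Cᶜ) (i : ℕ) :
    map R M (g.comp f) (hg.comp hf) i = map R M f hf i ≫ map R M g hg i := by
  rw [map, map, map, ← HomologicalComplex.homologyMap_comp, quotChainMap,
    Subcomplex.quotMap_congr (csingularChainComplex.map_comp (R := R) (M := M) f g)
      (hg := (Subcomplex.comap_comp _ _ (awaySub R M Z C)) ▸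
        (awaySub_le_comap R M f hf).trans (fun n c hc => awaySub_le_comap R M g hg n hc)),
    Subcomplex.quotMap_comp _ _ _ (awaySub R M Y B) _ (awaySub_le_comap R M f hf) (awaySub_le_comap R M g hg)]

/-- `f_*` only depends on `f` (proof irrelevance helper for rewriting the map). [folklore] -/
lemma map_congr {A : Set X} {B : Set Y} {f g : C(X, Y)} (hfg : f = g) (hf : Set.MapsTo f Aᶜ Bᶜ)
    (hg : Set.MapsTo g Aᶜ Bᶜ) (i : ℕ) : map R M f hf i = map R M g hg i := by
  subst hfg
  rfl

variable (X) in
/-- The restriction `Hᵢ(X | A) ⟶ Hᵢ(X | B)` for `B ⊆ A` (Hatcher 2002, §3.3, the maps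
`Hₙ(M | A) → Hₙ(M | x)`). [folklore] -/
def res {A B : Set X} (h : B ⊆ A) (i : ℕ) : clocalHomology R M X A i ⟶ clocalHomology R M X B i :=
  map R M (ContinuousMap.id X) (fun _ hx hB => hx (h hB)) i

/-- `res` for `A ⊆ A` is the identity. [folklore] -/
@[simp]
lemma res_self (A : Set X) (i : ℕ) : res R M X (subset_refl A) i = 𝟙 _ := map_id R M A _ i

/-- Restrictions compose. [folklore] -/
@[reassoc]
lemma res_comp_res {A B C : Set X} (h : B ⊆ A) (h' : C ⊆ B) (i : ℕ) :
    res R M X h i ≫ res R M X h' i = res R M X (h'.trans h) i :=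
  (map_comp R M _ _ _ _ i).symm

/-- Restriction is natural: `f_* ∘ res = res ∘ f_*`. [folklore] -/
@[reassoc]
lemma map_comp_res {A A' : Set X} {B B' : Set Y} (f : C(X, Y)) (h : Set.MapsTo f Aᶜ Bᶜ)
    (h' : Set.MapsTo f A'ᶜ B'ᶜ) (hA : A' ⊆ A) (hB : B' ⊆ B) (i : ℕ) :
    map R M f h i ≫ res R M Y hB i = res R M X hA i ≫ map R M f h' i := by
  rw [res, res, ← map_comp, ← map_comp]
  rfl

/-! ### Homeomorphism invariance -/

/-- A homeomorphism of pairs induces an isomorphism `Hᵢ(X | A) ≅ Hᵢ(Y | B)` when `e ⁻¹' B = A`. [folklore] -/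
def mapIsoOfHomeomorph (e : X ≃ₜ Y) {A : Set X} {B : Set Y} (h : e ⁻¹' B = A) (i : ℕ) :
    clocalHomology R M X A i ≅ clocalHomology R M Y B i where
  hom := map R M (e : C(X, Y)) (fun x (hx : x ∈ Aᶜ) (hB : e x ∈ B) => hx (by rw [← h]; exact hB)) i
  inv := map R M (e.symm : C(Y, X)) (fun y (hy : y ∈ Bᶜ) (hA : e.symm y ∈ A) => hy (by
      rw [← h] at hA
      simpa using hA)) i
  hom_inv_id := by
    have hfg : (e.symm : C(Y, X)).comp (e : C(X, Y)) = ContinuousMap.id X := by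
      ext x; exact e.symm_apply_apply x
    rw [← map_comp, map_congr R M hfg _ (fun _ h => h) i, map_id]
  inv_hom_id := by
    have hfg : (e : C(X, Y)).comp (e.symm : C(Y, X)) = ContinuousMap.id Y := by
      ext y; exact e.apply_symm_apply y
    rw [← map_comp, map_congr R M hfg _ (fun _ h => h) i, map_id]

/-- The map induced by a homeomorphism of pairs is an isomorphism. [folklore] -/
lemma isIso_map_homeomorph (e : X ≃ₜ Y) {A : Set X} {B : Set Y} (h : e ⁻¹' B = A) (i : ℕ) :
    IsIso (map R M (e : C(X, Y)) (fun x (hx : x ∈ Aᶜ) (hB : e x ∈ B) => hx (by rw [← h]; exact hB)) i) :=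
  (mapIsoOfHomeomorph R M e h i).isIso_hom

/-! ### Excision: `H(Ω | A) ≅ H(X | A)` for `A ⊆ Ω` closed, `Ω` open -/

/-- **Excision for local homology** (Hatcher 2002, Thm. 2.20 / §3.3: `Hᵢ(X | A) ≅ Hᵢ(Ω | A)` for
`Ω` an open neighbourhood of the closed set `A`): the map of pairs `(Ω, Ω ∖ A) → (X, X ∖ A)` induces
isomorphisms. [cite: HatcherAT2002, Thm. 2.20] -/
theorem isIso_map_val {Ω A : Set X} {A' : Set Ω} (hA' : A' = Subtype.val ⁻¹' A) (hΩ : IsOpen Ω)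
    (hA : IsClosed A) (hAΩ : A ⊆ Ω) (h : Set.MapsTo (Subtype.val : Ω → X) A'ᶜ Aᶜ) (i : ℕ) :
    IsIso (map R M (⟨Subtype.val, continuous_subtype_val⟩ : C(Ω, X)) h i) := by
  subst hA'
  -- factor the chain map through `T/(S ⊓ T)` with `T = C(Ω)`, `S = C(X ∖ A)`
  set T := chainsInSub R M X Ω with hT
  set S := awaySub R M X A with hS
  have hcomap : awaySub R M (↥Ω) (Subtype.val ⁻¹' A) = (S.comap T.ι).comap (subspaceLift R M X Ω) := by
    rw [hS, awaySub, awaySub, ← Set.preimage_compl, chainsInSub_preimage_val_eq_comap_lift]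
  haveI h1 : IsIso (Subcomplex.quotMap (subspaceLift R M X Ω) (awaySub R M (↥Ω) (Subtype.val ⁻¹' A))
      (S.comap T.ι) hcomap.le) := Subcomplex.isIso_quotMap _ _ _ hcomap
  have h2 := isIso_homologyMap_quotMap_excision R M hΩ hA.isOpen_compl
    (Set.eq_univ_of_forall fun x => (em (x ∈ A)).elim (fun h => Or.inl (hAΩ h)) Or.inr) i
  have hfac : quotChainMap R M (X := ↥Ω) (⟨Subtype.val, continuous_subtype_val⟩ : C(Ω, X)) h =
      Subcomplex.quotMap (subspaceLift R M X Ω) _ (S.comap T.ι) hcomap.le ≫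
        Subcomplex.quotMap T.ι (S.comap T.ι) S le_rfl := by
    rw [← Subcomplex.quotMap_comp (hfg := (Subcomplex.comap_comp _ _ S) ▸ hcomap.le)]
    exact Subcomplex.quotMap_congr (subspaceLift_ι R M Ω).symm _ _ _ _
  rw [map, hfac, HomologicalComplex.homologyMap_comp]
  haveI := h2
  infer_instance

/-! ### The long exact sequence of the pair `(X, X ∖ A)` -/

variable (X) in
/-- The connecting map `∂ : Hᵢ₊₁(X | A) ⟶ Hᵢ(C(X ∖ A))` of the pair `(X, X ∖ A)`
(Hatcher 2002, §2.1 Thm. 2.13 ff. / §3.3). [folklore] -/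
def δ (A : Set X) (i : ℕ) : clocalHomology R M X A (i + 1) ⟶ (awaySub R M X A).toComplex.homology i :=
  (awaySub R M X A).shortExact.δ (i + 1) i rfl

/-- The map of quotient complexes underlying `res` is `quotientMap`. [folklore] -/
lemma awaySub_mono {A B : Set X} (h : B ⊆ A) : awaySub R M X A ≤ awaySub R M X B :=
  chainsInSub_mono R M (Set.compl_subset_compl.mpr h)

/-- `res` is `H(quotientMap)`. [folklore] -/
lemma res_eq {A B : Set X} (h : B ⊆ A) (i : ℕ) :
    res R M X h i = HomologicalComplex.homologyMap (Subcomplex.quotientMap (awaySub_mono R M h)) i := by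
  rw [res, map, quotChainMap, Subcomplex.quotientMap]
  congr 1
  exact Subcomplex.quotMap_congr (csingularChainComplex.map_id (R := R) (M := M)) _ _ _ _

/-- Naturality of `∂` with respect to restriction: `∂ ∘ res = incl_* ∘ ∂` (Hatcher 2002, §2.1,
naturality of the long exact sequence of pairs). [folklore] -/
@[reassoc]
lemma δ_comp_incl {A B : Set X} (h : B ⊆ A) (i : ℕ) :
    δ R M X A i ≫ HomologicalComplex.homologyMap (Subcomplex.incl (awaySub_mono R M h)) i =
      res R M X h (i + 1) ≫ δ R M X B i := by
  rw [res_eq]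
  exact HomologicalComplex.HomologySequence.δ_naturality
    (Subcomplex.shortComplexMap (𝟙 _) (awaySub R M X A) (awaySub R M X B) (awaySub_mono R M h))
    (Subcomplex.shortExact _) (Subcomplex.shortExact _) (i + 1) i rfl

/-- If `Hᵢ₊₁(X) = 0` and `Hᵢ(X) = 0` then `∂ : Hᵢ₊₁(X | A) ⟶ Hᵢ(C(X ∖ A))` is an isomorphism
(long exact sequence of the pair). [folklore] -/
lemma isIso_δ (A : Set X) (i : ℕ) (h1 : IsZero (csingularHomology R M X (i + 1)))
    (h0 : IsZero (csingularHomology R M X i)) : IsIso (δ R M X A i) :=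
  (awaySub R M X A).shortExact.isIso_δ (i + 1) i rfl h1 h0

/-! ### Chains of nested subspaces -/

/-- Naturality of `subspaceLift` for nested subspaces `A ⊆ B`: co-restricting `C(↥A) → C(A)` and
including into `C(B)` is `C(↥A → ↥B)` co-restricted. [folklore] -/
@[reassoc]
lemma subspaceLift_comp_incl {A B : Set X} (h : A ⊆ B) :
    subspaceLift R M X A ≫ Subcomplex.incl (chainsInSub_mono R M h) =
      csingularChainComplex.map R M (⟨Set.inclusion h, continuous_inclusion h⟩ : C(A, B)) ≫
        subspaceLift R M X B := by
  rw [← cancel_mono (chainsInSub R M X B).ι, Category.assoc, Subcomplex.incl_ι, subspaceLift_ι,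
    Category.assoc, subspaceLift_ι, ← csingularChainComplex.map_comp]
  rfl

/-- `H(incl : C(A) → C(B))` is conjugate to `H(↥A → ↥B)`; in particular it is an isomorphism when the
inclusion of subspaces is a homotopy equivalence. [folklore] -/
lemma isIso_homologyMap_incl_of_isIso {A B : Set X} (h : A ⊆ B) (i : ℕ)
    (hiso : IsIso (csingularHomology.map R M (⟨Set.inclusion h, continuous_inclusion h⟩ : C(A, B)) i)) :
    IsIso (HomologicalComplex.homologyMap (Subcomplex.incl (chainsInSub_mono R M h)) i) := by
  have e : HomologicalComplex.homologyMap (Subcomplex.incl (chainsInSub_mono R M h)) i =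
      HomologicalComplex.homologyMap (inv (subspaceLift R M X A)) i ≫
        csingularHomology.map R M (⟨Set.inclusion h, continuous_inclusion h⟩ : C(A, B)) i ≫
          HomologicalComplex.homologyMap (subspaceLift R M X B) i := by
    rw [csingularHomology.map, ← HomologicalComplex.homologyMap_comp,
      ← HomologicalComplex.homologyMap_comp, ← subspaceLift_comp_incl, IsIso.inv_hom_id_assoc]
  rw [e]
  infer_instance

/-! ### `H(X | ∅) = 0` -/

/-- `Hᵢ(X | ∅) = 0` (`C(X ∖ ∅) = C(X)`). [folklore] -/
theorem isZero_empty (i : ℕ) : IsZero (clocalHomology R M X (∅ : Set X) i) := by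
  refine ShortComplex.isZero_homology_of_isZero_X₂ _ ?_
  change IsZero (ModuleCat.of R (_ ⧸ _))
  haveI : Subsingleton ((csingularChainComplex R M X).X i ⧸ (awaySub R M X (∅ : Set X)) i) := by
    refine ⟨fun a b => ?_⟩
    obtain ⟨a, rfl⟩ := Submodule.Quotient.mk_surjective _ a
    obtain ⟨b, rfl⟩ := Submodule.Quotient.mk_surjective _ b
    refine (Submodule.Quotient.eq _).mpr ?_
    change a - b ∈ chainsIn R M X (∅ : Set X)ᶜ i
    rw [Set.compl_empty, chainsIn_univ]
    trivial
  exact ModuleCat.isZero_of_subsingleton _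

/-! ### Hatcher's property `P(A)` of the proof of Lemma 3.27 (its theory is in `…NoncompactManifoldProofs`) -/

variable (X) in
/-- Hatcher's property `P(A)` from the proof of Lemma 3.27 (the uniqueness half of (a) together
with (b)): `Hᵢ(X | A; M) = 0` for `i > n`, and a class in `Hₙ(X | A; M)` whose restriction to
`Hₙ(X | x; M)` vanishes for every `x ∈ A` is zero. [cite: HatcherAT2002, Lemma 3.27] -/
def PtDetermined (n : ℕ) (A : Set X) : Prop :=
  (∀ i, n < i → IsZero (clocalHomology R M X A i)) ∧
    ∀ α : clocalHomology R M X A n,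
      (∀ (x : X) (hx : x ∈ A), res R M X (Set.singleton_subset_iff.mpr hx) n α = 0) → α = 0

end clocalHomology

end Literature.AlgebraicTopology.SingularHomology

end
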